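/-
Copyright (c) 2026 the pub-hodgecm-mathlib formalisation cell (harness21).  Prover seat hodgecm-mathlib-F0P3-p01 (g19): road «S3-ram» (LEAD F0P3a-plan (g13); owner lineage
F0P3a-p06 (g16), (Cnt2′) chair F0P3a-p07), organ (J2-FRAME-aniso) «CENTRING THE OPPOSITE LITERAL BY `u_w`» (statement A-p19 (g28) 03:53:10Z, released 03:54:40Z); 2026-09-02.
-/
import Literature.NumberTheory.Automorphic.UnitaryLatticeTreeCentralRescalingCountTransport   -- ★ (F0P3a-p05 (g17)): §1 central rescaling of the ELEMENT — `mapGL_eq_of_coe_eq_smul`, `map_toLin'_le_scaleLattice_of_eq_smul_add_smul`, `map_toLin'_sq_le_…`, `v_inv_mul_pairing_sub_lt_one_iff_…`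
import Literature.NumberTheory.Automorphic.UnitaryLatticeTreeAxisEndoFrame                     -- ★ `coe_endoGL_eq_endoShape`; brings ★ `endoGL` ∕ `endoForm` ∕ `endoGL_mem_iff`, ★ `map_sub_one_latt_le_scaleLattice_iff`, ★ `mapGL_stdLattice_eq_iff`, ★ `isIntMatrix_mul`
import Literature.NumberTheory.Automorphic.ValuedFieldValuativeRelBridge                       -- ★ `mem_glInt_iff_forall_v_le_one` (the `GL_N(𝒪)` bridge to ★ `glInt`)
import HarnessLib

/-!
# The lattice graph of a hermitian space — CENTRING A CONJUGATED `ι`-PATTERN LITERAL BY ITS MIDDLE EIGENVALUE: `P·ι(γ₁, u)·P⁻¹ ↦ P·ι(u⁻¹γ₁, 1)·P⁻¹ = u⁻¹·(P·ι(γ₁, u)·P⁻¹)`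
# (Rogawski 1990 §4.8 Case (a), §4.9; Kottwitz 1986 §3; Bruhat–Tits 1972 §10)

Topic `NumberTheory/Automorphic`; namespace `Literature.NumberTheory.Automorphic.UnitaryLatticeTree`.  THEOREMS ONLY (no definition, no instance, no notation, no named fact,
no `sorry`); kernel lane `--supports stmt-HodgeConjecture-24833`; datum-free (`K` with `Valued K ℤᵐ⁰`, any ring endomorphism `σ`, any form `J`).  Cell `pub/hodgecm-mathlib`
(D-0151), crux H413; road «S3-ram» (Literature seeding, count-neutral), the (Cnt2′) BLOCK-LAW skeleton (`stub_T2G_{zero,pm}_{even,odd}_J0diff`, keeper A-p19 (g28) → F0P3a-p06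
(g16)), organ **(J2-FRAME-aniso) «CENTRING THE OPPOSITE LITERAL BY `u_w`»** (A-p19 (g28) 2026-09-02 03:53:10Z; (F3) there = ★ `UnitaryLatticeTreeCentralRescalingCountTransport` §1).

THE SITUATION ([Rogawski1990] §4.8 Case (a) p. 53, §4.9 p. 55; [Kottwitz1986] §3).  The anisotropic type-(2) literal of the block law is the element
`Y = P·ι(γ₁, u)·P⁻¹` of `U(σ, J)` (`J = Φ₃` at the place), where `ι(γ₁, u)` is the `(∗ 0 ∗; 0 u 0; ∗ 0 ∗)` pattern ★ `endoGL (γ₁, u)`, `P ∈ GL₃(𝒪)` is a frame with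
`ᵗσ(P) J P = ι-shape(diag d, η)` (★ `formCongr`), `γ₁ ∈ U(σ, diag d)` and `u = (u₀₀)` a norm-one scalar (`σ(u₀₀)·u₀₀ = 1`) with `|u₀₀ − 1| ≤ |ϖ|²`.  The junction head
★ `strataCount_J₀_of_charpoly_block_raw[_singleton]` (F0P2-p02 (g14)) counts the `γ`-fixed self-dual lattices of an INTEGRAL `γ ∈ U(σ, J₀)` whose characteristic polynomial
is `(X − λ)·χ_B` with `|λ − 1|, |(B − 1)_{ij}| ≤ |ϖ|^{d₀}` and `(γ − 1)L₀ ⊆ ϖ^{d₀}L₀` — the TRUE depth `d₀` of the block, which `Y` itself does not have (its middle eigenvalue `u₀₀`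
is only `2`-deep).  CENTRING: replace `Y` by `Y′ := P·ι(u₀₀⁻¹γ₁, 1)·P⁻¹ = u₀₀⁻¹·Y` (§1: `ι(s·γ₁, s·u) = s·ι(γ₁, u)` and scalars are central).  Then (§2) `Y′ ∈ U(σ, J)`
(`s := u₀₀⁻¹` is again norm-one), (§3) `Y′, Y′⁻¹` are integral when `P, P⁻¹, γ₁, γ₁⁻¹` are, (§4) `χ_{Y′} = (X − 1)·χ_{sγ₁}` (conjugation invariance + the block pattern),
`|(sγ₁ − 1)_{ij}| ≤ C` as soon as `|(γ₁ − u₀₀·1)_{ij}| ≤ C` (`sγ₁ − 1 = s(γ₁ − u₀₀·1)`, `|s| = 1`), and `(Y′ − 1)L₀ ⊆ c·L₀` as soon as `|(sγ₁ − 1)_{ij}| ≤ |c|`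
(`P·L₀ = L₀` for `P ∈ GL₃(𝒪)`, ★ `map_sub_one_latt_le_scaleLattice_iff` in the frame `P`) — these are the `hchar ∕ hlam ∕ hBm ∕ hroot` inputs of the junction head AT `Y′`
with `λ := 1`, `B := s·γ₁`; and (§5) the five STRATA SETS of the block law (fixedness, the level tokens `LEV(ϖ)`, `LEV(ϖ²)`, the square token `LEV₂(ϖ³)` and the class
tokens «`|ϖ⁻¹B_J(y, (T − 1)y) − C·a²| < 1`» on self-dual `M`) are THE SAME for `T″ = s·T` and `T` whenever `|s| = 1`, `|s − 1| ≤ |ϖ|²` — the `fin_cases` packaging of ★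
`UnitaryLatticeTreeCentralRescalingCountTransport` §1 for an ARBITRARY (non-diagonal) `T` and one fixed form on both sides (the ★ §2 there is the diagonal-model∕`J₀`-model
transport and does not state this) — together with the equality of the fixed-vertex sets (so `hFfin`-type finiteness moves between `Y` and `Y′`).  Everything is elementary
matrix algebra over a valuation ring; the consumer instantiates `K := L_w`, `σ := σ_w`, `J := Φ₃,w`, `P := P₁`, `u := u_w` (the `hBlockLaw` binders `hP₁ hform hγU`).
HONEST LABEL: HC_CM is proved only modulo the 2 remaining named inputs (hLiu418 24832, h413 24833) until rung 0 closes; nothing printed is asserted here; «S3-ram» has no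
books consequence.

* §1 `charpoly_oneByOne`, `charpoly_coe_endoGL`, `charpoly_coe_conj_endoGL`, `endoGL_scalar`, `endoGL_scalar_mul_eq_scalar_mul_endoGL`, `conj_scalar_mul_eq_scalar_mul_conj`,
  `coe_scalar_mul_eq_smul`, **`conj_endoGL_centred_eq`** ∕ **`coe_conj_endoGL_centred_eq_smul`** (`P·ι(sγ₁, 1)·P⁻¹ = s·(P·ι(γ₁, u)·P⁻¹)` for `s·u₀₀ = 1`),
  `isRoot_charpoly_smul_iff` ∕ `forall_not_isRoot_charpoly_smul` ∕ `not_exists_isRoot_charpoly_smul` (rootlessness survives centring), `trace_sq_sub_four_mul_det_smul`,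
  `coe_oneByOne_ne_zero`.
* §2 `oneByOne_mem_unitaryGroupOfForm_of_norm_eq_one`, `scalar_mul_mem_unitaryGroupOfForm`, `endoForm_diagonal_oneByOne_eq`, **`conj_endoGL_mem_unitaryGroupOfForm_of_formCongr_eq`**,
  **`conj_endoGL_centred_mem_unitaryGroupOfForm_of_formCongr_eq`**.
* §3 `isIntMatrix_coe_endoGL`, `isIntMatrix_coe_conj`, `isIntMatrix_coe_conj_endoGL` ∕ `…_inv`, `v_sub_smul_one_apply_le_of_le`, `v_smul_sub_one_apply_le_of_mul_eq_one`,
  `isIntMatrix_of_forall_v_sub_one_le_of_lt_one` ∕ `…_coe_inv_…`, `v_trace_sq_sub_four_mul_det_smul` (`|disc(s·A)| = |disc A|`), `forall_v_smul_apply_le_one`,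
  `mem_glInt_conj_endoGL_of_isIntMatrix`, `mem_unitaryInt_of_isIntMatrix`.
* §4 **`charpoly_coe_conj_endoGL_one`**, **`map_sub_one_stdLattice_le_scaleLattice_of_conj_endoGL`** (the `hchar ∕ hBm ∕ hroot` inputs at the centred literal).
* §5 **`setOf_strata_eq_of_coe_eq_smul`**, `ncard_strata_eq_of_coe_eq_smul`, **`latticeGraphIso_eq_self_iff_of_coe_eq_smul`**, `setOf_latticeGraphIso_eq_self_eq_of_coe_eq_smul`.

## References
* [Rogawski1990] J. D. Rogawski, *Automorphic Representations of Unitary Groups in Three Variables*, Ann. of Math. Stud. 123 (1990), §4.8 Case (a) p. 53 (the pattern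
  `ι : U(2) × U(1) → U(3)`), §4.9 pp. 54–55, Lemma 4.9.3 (labels of `γ`-fixed lattices; the count is taken in a convenient model).
* [Kottwitz1986] R. E. Kottwitz, *Base change for unit elements of Hecke algebras*, Compositio Math. 60 (1986), §3 (counting `γ`-fixed lattices; central modifications).
* [BruhatTits1972] F. Bruhat, J. Tits, *Groupes réductifs sur un corps local I*, Publ. Math. IHÉS 41 (1972), §10 (the lattice model; homotheties act trivially on the building).
* [Serre1980Trees] J.-P. Serre, *Trees* (1980), Ch. II §1.1 (lattices up to homothety; `Stab(L₀) = GL_N(𝒪)`).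
* [Serre1979] J.-P. Serre, *Local Fields* (1979), Ch. II §1 (valuation rings, units).
-/

set_option autoImplicit false

noncomputable section

open scoped Valued WithZero Matrix MatrixGroups
open Polynomial

namespace Literature.NumberTheory.Automorphic.UnitaryLatticeTree

open Literature.NumberTheory.Automorphic Literature.NumberTheory.Automorphic.HermitianLattice Literature.NumberTheory.Rogawski1990

/-! ## §1 Algebra of the pattern `ι(γ₁, u)` and of its centring (any field) -/

section Algebra

variable {K : Type*} [Field K]

/-- The characteristic polynomial of a `1 × 1` matrix `(a)` is `X − a`. [cite: Serre1979, Ch. II §1] -/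
theorem charpoly_oneByOne (A : Matrix (Fin 1) (Fin 1) K) : A.charpoly = X - C (A 0 0) := by
  have hA : A = Matrix.diagonal fun _ => A 0 0 := by
    ext i j; fin_cases i; fin_cases j; rfl
  conv_lhs => rw [hA]
  rw [Matrix.charpoly_diagonal, Fin.prod_univ_one]

/-- **`χ_{ι(a, b)} = (X − b₀₀)·χ_a`** — the pattern `ι(a, b)` is `reindex (a ⊕ b)` (★ `coe_endoGL`), so its characteristic polynomial is `χ_a · χ_b` (`Matrix.charpoly_reindex`,
`Matrix.charpoly_fromBlocks_zero₁₂`) and `χ_b = X − b₀₀`. [cite: Rogawski1990, §4.8 Case (a) p. 53] -/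
theorem charpoly_coe_endoGL (a : GL (Fin 2) K) (b : GL (Fin 1) K) :
    ((endoGL (a, b) : GL (Fin 3) K) : Matrix (Fin 3) (Fin 3) K).charpoly = (X - C ((b : Matrix (Fin 1) (Fin 1) K) 0 0)) * (a : Matrix (Fin 2) (Fin 2) K).charpoly := by
  rw [coe_endoGL, Matrix.charpoly_reindex, Matrix.charpoly_fromBlocks_zero₁₂, charpoly_oneByOne, mul_comm]

/-- **`χ_{P·ι(a, b)·P⁻¹} = (X − b₀₀)·χ_a`** (conjugation invariance `Matrix.charpoly_units_conj` + `charpoly_coe_endoGL`). [cite: Rogawski1990, §4.8 Case (a) p. 53; §3.1 p. 19] -/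
theorem charpoly_coe_conj_endoGL (P : GL (Fin 3) K) (a : GL (Fin 2) K) (b : GL (Fin 1) K) :
    ((P * endoGL (a, b) * P⁻¹ : GL (Fin 3) K) : Matrix (Fin 3) (Fin 3) K).charpoly =
      (X - C ((b : Matrix (Fin 1) (Fin 1) K) 0 0)) * (a : Matrix (Fin 2) (Fin 2) K).charpoly := by
  rw [Units.val_mul, Units.val_mul, Matrix.coe_units_inv, Matrix.charpoly_units_conj, charpoly_coe_endoGL]

/-- `ι(s·1₂, s·1₁) = s·1₃`: the pattern of two scalar blocks is the scalar. [cite: Rogawski1990, §4.8 Case (a) p. 53] -/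
theorem endoGL_scalar (s : Kˣ) :
    endoGL (Matrix.GeneralLinearGroup.scalar (Fin 2) s, Matrix.GeneralLinearGroup.scalar (Fin 1) s) = Matrix.GeneralLinearGroup.scalar (Fin 3) s := by
  apply Units.ext
  rw [coe_endoGL_eq, Matrix.GeneralLinearGroup.coe_scalar, Matrix.GeneralLinearGroup.coe_scalar, Matrix.GeneralLinearGroup.coe_scalar,
    Matrix.scalar_apply, Matrix.scalar_apply, Matrix.scalar_apply]
  ext i j
  fin_cases i <;> fin_cases j <;> simp

/-- The matrix of `s·g` (`s` a central unit of `GL_N`): `↑(scalar s · g) = s • ↑g`. [cite: Serre1980Trees, Ch. II §1.1] -/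
theorem coe_scalar_mul_eq_smul {N : ℕ} (s : Kˣ) (g : GL (Fin N) K) :
    ((Matrix.GeneralLinearGroup.scalar (Fin N) s * g : GL (Fin N) K) : Matrix (Fin N) (Fin N) K) = (s : K) • (g : Matrix (Fin N) (Fin N) K) := by
  rw [Units.val_mul, Matrix.GeneralLinearGroup.coe_scalar, Matrix.scalar_apply, ← Matrix.smul_eq_diagonal_mul]

/-- **CENTRING THE PATTERN**: for a unit `s` with `s·b₀₀ = 1`, `ι(s·a, 1) = s·ι(a, b)` (`ι` is a homomorphism, ★ `endoGL`; `s·b = 1` in `GL₁`; `ι(s, s) = s`).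
[cite: Rogawski1990, §4.8 Case (a) p. 53] [cite: Kottwitz1986, §3] -/
theorem endoGL_scalar_mul_eq_scalar_mul_endoGL (a : GL (Fin 2) K) (b : GL (Fin 1) K) (s : Kˣ) (hs : (s : K) * (b : Matrix (Fin 1) (Fin 1) K) 0 0 = 1) :
    endoGL (Matrix.GeneralLinearGroup.scalar (Fin 2) s * a, (1 : GL (Fin 1) K)) = Matrix.GeneralLinearGroup.scalar (Fin 3) s * endoGL (a, b) := by
  have hb : Matrix.GeneralLinearGroup.scalar (Fin 1) s * b = 1 := by
    apply Units.ext
    rw [coe_scalar_mul_eq_smul, Units.val_one]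
    ext i j; fin_cases i; fin_cases j
    simp [hs]
  have hpair : ((Matrix.GeneralLinearGroup.scalar (Fin 2) s * a, (1 : GL (Fin 1) K)) : GL (Fin 2) K × GL (Fin 1) K) =
      (Matrix.GeneralLinearGroup.scalar (Fin 2) s, Matrix.GeneralLinearGroup.scalar (Fin 1) s) * (a, b) := by
    rw [Prod.mk_mul_mk, hb]
  rw [hpair, map_mul, endoGL_scalar]

/-- Scalars are central: `P·(s·E)·P⁻¹ = s·(P·E·P⁻¹)`. [cite: Serre1980Trees, Ch. II §1.1] -/
theorem conj_scalar_mul_eq_scalar_mul_conj {N : ℕ} (P E : GL (Fin N) K) (s : Kˣ) :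
    P * (Matrix.GeneralLinearGroup.scalar (Fin N) s * E) * P⁻¹ = Matrix.GeneralLinearGroup.scalar (Fin N) s * (P * E * P⁻¹) := by
  rw [← mul_assoc P, ← Matrix.GeneralLinearGroup.scalar_commute s P]
  simp only [mul_assoc]

/-- **THE CENTRED LITERAL**: `P·ι(s·γ₁, 1)·P⁻¹ = s·(P·ι(γ₁, u)·P⁻¹)` for `s·u₀₀ = 1` — as elements of `GL₃`. [cite: Rogawski1990, §4.8 Case (a) p. 53; §4.9 p. 55] [cite: Kottwitz1986, §3] -/
theorem conj_endoGL_centred_eq (P : GL (Fin 3) K) (γ₁ : GL (Fin 2) K) (u : GL (Fin 1) K) (s : Kˣ) (hs : (s : K) * (u : Matrix (Fin 1) (Fin 1) K) 0 0 = 1) :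
    P * endoGL (Matrix.GeneralLinearGroup.scalar (Fin 2) s * γ₁, (1 : GL (Fin 1) K)) * P⁻¹ =
      Matrix.GeneralLinearGroup.scalar (Fin 3) s * (P * endoGL (γ₁, u) * P⁻¹) := by
  rw [endoGL_scalar_mul_eq_scalar_mul_endoGL γ₁ u s hs, conj_scalar_mul_eq_scalar_mul_conj]

/-- **THE CENTRED LITERAL, as matrices**: `↑(P·ι(s·γ₁, 1)·P⁻¹) = s • ↑(P·ι(γ₁, u)·P⁻¹)` for `s·u₀₀ = 1` — the `hTT`-shape hypothesis of ★
`UnitaryLatticeTreeCentralRescalingCountTransport` §1 and of §5 below. [cite: Rogawski1990, §4.9 p. 55] [cite: Kottwitz1986, §3] -/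
theorem coe_conj_endoGL_centred_eq_smul (P : GL (Fin 3) K) (γ₁ : GL (Fin 2) K) (u : GL (Fin 1) K) (s : Kˣ) (hs : (s : K) * (u : Matrix (Fin 1) (Fin 1) K) 0 0 = 1) :
    ((P * endoGL (Matrix.GeneralLinearGroup.scalar (Fin 2) s * γ₁, (1 : GL (Fin 1) K)) * P⁻¹ : GL (Fin 3) K) : Matrix (Fin 3) (Fin 3) K) =
      (s : K) • ((P * endoGL (γ₁, u) * P⁻¹ : GL (Fin 3) K) : Matrix (Fin 3) (Fin 3) K) := by
  rw [conj_endoGL_centred_eq P γ₁ u s hs, coe_scalar_mul_eq_smul]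

/-- The matrix of the centred block: `↑(s·γ₁) = s • ↑γ₁`. [cite: Serre1980Trees, Ch. II §1.1] -/
theorem coe_scalar_mul_two_eq_smul (s : Kˣ) (γ₁ : GL (Fin 2) K) :
    ((Matrix.GeneralLinearGroup.scalar (Fin 2) s * γ₁ : GL (Fin 2) K) : Matrix (Fin 2) (Fin 2) K) = (s : K) • (γ₁ : Matrix (Fin 2) (Fin 2) K) :=
  coe_scalar_mul_eq_smul s γ₁

/-- **ROOTLESSNESS SURVIVES CENTRING** (`2 × 2`): for `s ≠ 0`, `χ_{s·A}(x) = 0 ↔ χ_A(s⁻¹x) = 0` (`χ_{s·A} = X² − s·tr A·X + s²·det A`, `Matrix.charpoly_fin_two`); so `s·A`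
is rootless over `K` iff `A` is — the `hirr` input of ★ `finite_setOf_latticeGraphIso_antidiagonal_eq_of_coe_eq_conj_endoGL` ∕ ★ `eq_root_of_…` at the centred block.
[cite: Rogawski1990, §4.9 p. 55] [cite: Kottwitz1986, §3] -/
theorem isRoot_charpoly_smul_iff {s : K} (hs : s ≠ 0) (A : Matrix (Fin 2) (Fin 2) K) (x : K) :
    (s • A).charpoly.IsRoot x ↔ A.charpoly.IsRoot (s⁻¹ * x) := by
  rw [Polynomial.IsRoot.def, Polynomial.IsRoot.def, Matrix.charpoly_fin_two, Matrix.charpoly_fin_two, Matrix.trace_smul, Matrix.det_smul, Fintype.card_fin,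
    smul_eq_mul]
  simp only [eval_add, eval_sub, eval_pow, eval_X, eval_mul, eval_C]
  have key : x ^ 2 - s * A.trace * x + s ^ 2 * A.det = s ^ 2 * ((s⁻¹ * x) ^ 2 - A.trace * (s⁻¹ * x) + A.det) := by
    field_simp
  rw [key, mul_eq_zero, or_iff_right (pow_ne_zero 2 hs)]

/-- … in the `∀ x, ¬ IsRoot` spelling of the block-law sockets: `A` rootless ⇒ `s·A` rootless (`s ≠ 0`). [cite: Rogawski1990, §4.9 p. 55] [cite: Kottwitz1986, §3] -/
theorem forall_not_isRoot_charpoly_smul {s : K} (hs : s ≠ 0) {A : Matrix (Fin 2) (Fin 2) K} (hirr : ∀ x : K, ¬ A.charpoly.IsRoot x) :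
    ∀ x : K, ¬ (s • A).charpoly.IsRoot x := fun x h =>
  hirr (s⁻¹ * x) ((isRoot_charpoly_smul_iff hs A x).1 h)

/-- … and in the `¬ ∃ x, IsRoot` spelling of the `hBlockLaw` binder `hirrγ`. [cite: Rogawski1990, §4.9 p. 55] [cite: Kottwitz1986, §3] -/
theorem not_exists_isRoot_charpoly_smul {s : K} (hs : s ≠ 0) {A : Matrix (Fin 2) (Fin 2) K} (hirr : ¬ ∃ x : K, A.charpoly.IsRoot x) :
    ¬ ∃ x : K, (s • A).charpoly.IsRoot x := fun ⟨x, h⟩ =>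
  hirr ⟨s⁻¹ * x, (isRoot_charpoly_smul_iff hs A x).1 h⟩

/-- `disc(s·A) = s²·disc A` for `2 × 2` matrices (`disc = tr² − 4·det`; `Matrix.trace_smul`, `Matrix.det_smul`). [cite: Rogawski1990, §4.9 p. 55] -/
theorem trace_sq_sub_four_mul_det_smul (s : K) (A : Matrix (Fin 2) (Fin 2) K) :
    (s • A).trace ^ 2 - 4 * (s • A).det = s ^ 2 * (A.trace ^ 2 - 4 * A.det) := by
  rw [Matrix.trace_smul, Matrix.det_smul, Fintype.card_fin, smul_eq_mul]; ring

/-- The entry of an invertible `1 × 1` matrix is non-zero (it is the determinant). [cite: Serre1979, Ch. II §1] -/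
theorem coe_oneByOne_ne_zero (u : GL (Fin 1) K) : (u : Matrix (Fin 1) (Fin 1) K) 0 0 ≠ 0 := by
  intro h
  have hu := (Matrix.isUnits_det_units u).ne_zero
  rw [Matrix.det_fin_one] at hu
  exact hu h

/-- The centring scalar exists: `∃ s ∈ Kˣ, s·u₀₀ = 1` (`s = u₀₀⁻¹`). [cite: Serre1979, Ch. II §1] -/
theorem exists_units_mul_oneByOne_eq_one (u : GL (Fin 1) K) : ∃ s : Kˣ, (s : K) * (u : Matrix (Fin 1) (Fin 1) K) 0 0 = 1 :=
  ⟨(Units.mk0 _ (coe_oneByOne_ne_zero u))⁻¹, by rw [Units.val_inv_eq_inv_val, Units.val_mk0, inv_mul_cancel₀ (coe_oneByOne_ne_zero u)]⟩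

end Algebra

/-! ## §2 Unitarity: `P·ι(γ₁, u)·P⁻¹ ∈ U(σ, J)` from the frame identity `ᵗσ(P) J P = ι-shape(diag d, η)`, and the same for the centred literal -/

section Unitary

variable {K : Type*} [Field K] {σ : K →+* K}

/-- A norm-one scalar `u₀₀` (`σ(u₀₀)·u₀₀ = 1`) is unitary for every `1 × 1` form `(η)`. [cite: Rogawski1990, §4.8 Case (a) p. 53] -/
theorem oneByOne_mem_unitaryGroupOfForm_of_norm_eq_one (η : K) {u : GL (Fin 1) K} (hu : σ ((u : Matrix (Fin 1) (Fin 1) K) 0 0) * (u : Matrix (Fin 1) (Fin 1) K) 0 0 = 1) :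
    u ∈ unitaryGroupOfForm σ (!![η] : Matrix (Fin 1) (Fin 1) K) := by
  rw [mem_unitaryGroupOfForm_iff]
  ext i j; fin_cases i; fin_cases j
  simp only [Matrix.mul_apply, Fin.sum_univ_one, Matrix.transpose_apply, Matrix.map_apply, Fin.zero_eta, Fin.isValue, Matrix.of_apply, Matrix.cons_val',
    Matrix.cons_val_fin_one]
  linear_combination η * hu

/-- **A norm-one central rescaling stays unitary**: `g ∈ U(σ, J)`, `σ(s)·s = 1` ⇒ `s·g ∈ U(σ, J)` (`ᵗσ(s·g) J (s·g) = (σ(s)·s)·ᵗσ(g) J g`). [cite: Kottwitz1986, §3] [cite: Rogawski1990, §4.9 p. 55] -/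
theorem scalar_mul_mem_unitaryGroupOfForm {N : ℕ} {J : Matrix (Fin N) (Fin N) K} {g : GL (Fin N) K} (hg : g ∈ unitaryGroupOfForm σ J) (s : Kˣ) (hs : σ (s : K) * (s : K) = 1) :
    Matrix.GeneralLinearGroup.scalar (Fin N) s * g ∈ unitaryGroupOfForm σ J := by
  rw [mem_unitaryGroupOfForm_iff] at hg ⊢
  have hmap : ((s : K) • (g : Matrix (Fin N) (Fin N) K)).map σ = σ (s : K) • (g : Matrix (Fin N) (Fin N) K).map σ := by
    ext i j; simp [Matrix.map_apply, smul_eq_mul]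
  rw [coe_scalar_mul_eq_smul, hmap, Matrix.transpose_smul, Matrix.smul_mul, Matrix.smul_mul, Matrix.mul_smul, smul_smul, hs, one_smul, hg]

/-- The printed `ι`-shape of a diagonal plane and a line is the block form `endoForm (diag d) (η)` (★ `endoForm_eq`). [cite: Rogawski1990, §4.8 Case (a) p. 53] -/
theorem endoForm_diagonal_oneByOne_eq (d : Fin 2 → K) (η : K) :
    endoForm (Matrix.diagonal d) (!![η] : Matrix (Fin 1) (Fin 1) K) =
      !![(Matrix.diagonal d) 0 0, 0, (Matrix.diagonal d) 0 1; 0, η, 0; (Matrix.diagonal d) 1 0, 0, (Matrix.diagonal d) 1 1] := by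
  rw [endoForm_eq]; rfl

/-- **(F1) THE CONJUGATED LITERAL IS UNITARY**: if `ᵗσ(P) J P = ι-shape(diag d, η)` (the frame identity `hform` of the block law), `γ₁ ∈ U(σ, diag d)` and `u = (u₀₀)` is
norm-one (`σ(u₀₀)·u₀₀ = 1`), then `P·ι(γ₁, u)·P⁻¹ ∈ U(σ, J)` (★ `conj_mem_unitaryGroupOfForm_iff` + ★ `endoGL_mem_iff`). [cite: Rogawski1990, §4.8 Case (a) p. 53; §4.9 p. 55] [cite: Kottwitz1986, §3] -/
theorem conj_endoGL_mem_unitaryGroupOfForm_of_formCongr_eq {J : Matrix (Fin 3) (Fin 3) K} {P : GL (Fin 3) K} {d : Fin 2 → K} {η : K}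
    (hform : formCongr σ P J = !![(Matrix.diagonal d) 0 0, 0, (Matrix.diagonal d) 0 1; 0, η, 0; (Matrix.diagonal d) 1 0, 0, (Matrix.diagonal d) 1 1])
    {γ₁ : GL (Fin 2) K} (hγU : γ₁ ∈ unitaryGroupOfForm σ (Matrix.diagonal d))
    {u : GL (Fin 1) K} (hu : σ ((u : Matrix (Fin 1) (Fin 1) K) 0 0) * (u : Matrix (Fin 1) (Fin 1) K) 0 0 = 1) :
    P * endoGL (γ₁, u) * P⁻¹ ∈ unitaryGroupOfForm σ J := by
  rw [conj_mem_unitaryGroupOfForm_iff, hform, ← endoForm_diagonal_oneByOne_eq, endoGL_mem_iff]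
  exact ⟨hγU, oneByOne_mem_unitaryGroupOfForm_of_norm_eq_one η hu⟩

/-- **(F1′) THE CENTRED LITERAL IS UNITARY**: with the same frame identity, `γ₁ ∈ U(σ, diag d)` and a norm-one scalar `s` (`σ(s)·s = 1`; `s = u₀₀⁻¹`),
`P·ι(s·γ₁, 1)·P⁻¹ ∈ U(σ, J)`. [cite: Rogawski1990, §4.8 Case (a) p. 53; §4.9 p. 55] [cite: Kottwitz1986, §3] -/
theorem conj_endoGL_centred_mem_unitaryGroupOfForm_of_formCongr_eq {J : Matrix (Fin 3) (Fin 3) K} {P : GL (Fin 3) K} {d : Fin 2 → K} {η : K}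
    (hform : formCongr σ P J = !![(Matrix.diagonal d) 0 0, 0, (Matrix.diagonal d) 0 1; 0, η, 0; (Matrix.diagonal d) 1 0, 0, (Matrix.diagonal d) 1 1])
    {γ₁ : GL (Fin 2) K} (hγU : γ₁ ∈ unitaryGroupOfForm σ (Matrix.diagonal d)) (s : Kˣ) (hs : σ (s : K) * (s : K) = 1) :
    P * endoGL (Matrix.GeneralLinearGroup.scalar (Fin 2) s * γ₁, (1 : GL (Fin 1) K)) * P⁻¹ ∈ unitaryGroupOfForm σ J :=
  conj_endoGL_mem_unitaryGroupOfForm_of_formCongr_eq hform (scalar_mul_mem_unitaryGroupOfForm hγU s hs)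
    (by rw [Units.val_one, Matrix.one_apply_eq, map_one, mul_one])

/-- The inverse of a norm-one scalar is norm-one: `σ(u₀₀)·u₀₀ = 1`, `s·u₀₀ = 1` ⇒ `σ(s)·s = 1`. [cite: Serre1979, Ch. II §1] -/
theorem norm_eq_one_of_mul_eq_one_of_norm_eq_one {t s : K} (ht : σ t * t = 1) (hs : s * t = 1) : σ s * s = 1 := by
  have ht0 : t ≠ 0 := fun h => by rw [h, mul_zero] at ht; exact zero_ne_one ht
  have hσt0 : σ t ≠ 0 := fun h => by rw [h, zero_mul] at ht; exact zero_ne_one ht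
  have hs' : s = t⁻¹ := eq_inv_of_mul_eq_one_left hs
  rw [hs', map_inv₀, ← mul_inv, inv_eq_one]
  exact ht

end Unitary

/-! ## §3 Integrality: `P·ι(γ₁, u)·P⁻¹ ∈ GL₃(𝒪)` and the entrywise depth of the centred block -/

section Integral

variable {K : Type*} [Field K] [Valued K ℤᵐ⁰]

/-- The entries of `ι(a, b)` are entries of `a`, of `b`, or `0`: `ι(a, b)` is integral when `a`, `b` are. [cite: Rogawski1990, §4.8 Case (a) p. 53] [cite: Serre1980Trees, Ch. II §1.1] -/
theorem isIntMatrix_coe_endoGL {a : GL (Fin 2) K} {b : GL (Fin 1) K} (ha : IsIntMatrix (a : Matrix (Fin 2) (Fin 2) K)) (hb : IsIntMatrix (b : Matrix (Fin 1) (Fin 1) K)) :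
    IsIntMatrix ((endoGL (a, b) : GL (Fin 3) K) : Matrix (Fin 3) (Fin 3) K) := by
  intro i j
  rw [coe_endoGL_eq]
  fin_cases i <;> fin_cases j <;> simp [ha _ _, hb _ _]

/-- `P·E·P⁻¹` is integral when `P`, `P⁻¹`, `E` are (★ `isIntMatrix_mul`). [cite: Serre1980Trees, Ch. II §1.1] -/
theorem isIntMatrix_coe_conj {N : ℕ} {P E : GL (Fin N) K} (hP : IsIntMatrix (P : Matrix (Fin N) (Fin N) K)) (hPi : IsIntMatrix ((P⁻¹ : GL (Fin N) K) : Matrix (Fin N) (Fin N) K))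
    (hE : IsIntMatrix (E : Matrix (Fin N) (Fin N) K)) : IsIntMatrix ((P * E * P⁻¹ : GL (Fin N) K) : Matrix (Fin N) (Fin N) K) := by
  rw [Units.val_mul, Units.val_mul]
  exact isIntMatrix_mul (isIntMatrix_mul hP hE) hPi

/-- **`P·ι(a, b)·P⁻¹` is integral** for `P, P⁻¹, a, b` integral. [cite: Rogawski1990, §4.8 Case (a) p. 53; §4.9 p. 54] [cite: Serre1980Trees, Ch. II §1.1] -/
theorem isIntMatrix_coe_conj_endoGL {P : GL (Fin 3) K} (hP : IsIntMatrix (P : Matrix (Fin 3) (Fin 3) K)) (hPi : IsIntMatrix ((P⁻¹ : GL (Fin 3) K) : Matrix (Fin 3) (Fin 3) K))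
    {a : GL (Fin 2) K} {b : GL (Fin 1) K} (ha : IsIntMatrix (a : Matrix (Fin 2) (Fin 2) K)) (hb : IsIntMatrix (b : Matrix (Fin 1) (Fin 1) K)) :
    IsIntMatrix ((P * endoGL (a, b) * P⁻¹ : GL (Fin 3) K) : Matrix (Fin 3) (Fin 3) K) :=
  isIntMatrix_coe_conj hP hPi (isIntMatrix_coe_endoGL ha hb)

/-- **… and so is its inverse** `(P·ι(a, b)·P⁻¹)⁻¹ = P·ι(a⁻¹, b⁻¹)·P⁻¹`, for `a⁻¹, b⁻¹` integral. [cite: Rogawski1990, §4.8 Case (a) p. 53; §4.9 p. 54] [cite: Serre1980Trees, Ch. II §1.1] -/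
theorem isIntMatrix_coe_conj_endoGL_inv {P : GL (Fin 3) K} (hP : IsIntMatrix (P : Matrix (Fin 3) (Fin 3) K)) (hPi : IsIntMatrix ((P⁻¹ : GL (Fin 3) K) : Matrix (Fin 3) (Fin 3) K))
    {a : GL (Fin 2) K} {b : GL (Fin 1) K} (ha : IsIntMatrix ((a⁻¹ : GL (Fin 2) K) : Matrix (Fin 2) (Fin 2) K)) (hb : IsIntMatrix ((b⁻¹ : GL (Fin 1) K) : Matrix (Fin 1) (Fin 1) K)) :
    IsIntMatrix (((P * endoGL (a, b) * P⁻¹)⁻¹ : GL (Fin 3) K) : Matrix (Fin 3) (Fin 3) K) := by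
  have h : (P * endoGL (a, b) * P⁻¹)⁻¹ = P * endoGL (a⁻¹, b⁻¹) * P⁻¹ := by
    rw [mul_inv_rev, mul_inv_rev, inv_inv, ← map_inv, Prod.inv_mk, mul_assoc]
  rw [h]
  exact isIntMatrix_coe_conj_endoGL hP hPi ha hb

/-- From `|(A − 1)_{ij}| ≤ C₁` and `|t − 1| ≤ C₁`: `|(A − t·1)_{ij}| ≤ C₁` (`A − t·1 = (A − 1) − (t − 1)·1`, ultrametric). [cite: Serre1979, Ch. II §1] -/
theorem v_sub_smul_one_apply_le_of_le {N : ℕ} {A : Matrix (Fin N) (Fin N) K} {t : K} {C₁ : ℤᵐ⁰} (hA : ∀ i j, Valued.v ((A - 1) i j) ≤ C₁) (ht : Valued.v (t - 1) ≤ C₁) :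
    ∀ i j, Valued.v ((A - t • (1 : Matrix (Fin N) (Fin N) K)) i j) ≤ C₁ := by
  intro i j
  have e : (A - t • (1 : Matrix (Fin N) (Fin N) K)) i j = (A - 1) i j - (t - 1) * (1 : Matrix (Fin N) (Fin N) K) i j := by
    simp only [Matrix.sub_apply, Matrix.smul_apply, smul_eq_mul]; ring
  rw [e]
  refine (Valuation.map_sub _ _ _).trans (max_le (hA i j) ?_)
  rw [map_mul]
  rcases eq_or_ne i j with rfl | hij
  · rw [Matrix.one_apply_eq, map_one, mul_one]; exact ht
  · rw [Matrix.one_apply_ne hij, map_zero, mul_zero]; exact zero_le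

/-- **THE CENTRED BLOCK KEEPS THE DEPTH**: `s·t = 1`, `|s| ≤ 1`, `|(A − t·1)_{ij}| ≤ C` ⇒ `|(s·A − 1)_{ij}| ≤ C` (`s·A − 1 = s·(A − t·1)`). [cite: Kottwitz1986, §3] [cite: Serre1979, Ch. II §1] -/
theorem v_smul_sub_one_apply_le_of_mul_eq_one {N : ℕ} {A : Matrix (Fin N) (Fin N) K} {s t : K} (hst : s * t = 1) (hs : Valued.v s ≤ 1) {C : ℤᵐ⁰}
    (hA : ∀ i j, Valued.v ((A - t • (1 : Matrix (Fin N) (Fin N) K)) i j) ≤ C) :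
    ∀ i j, Valued.v ((s • A - 1) i j) ≤ C := by
  have e : s • A - 1 = s • (A - t • (1 : Matrix (Fin N) (Fin N) K)) := by
    rw [smul_sub, smul_smul, hst, one_smul]
  intro i j
  rw [e, Matrix.smul_apply, smul_eq_mul, map_mul]
  calc Valued.v s * Valued.v ((A - t • (1 : Matrix (Fin N) (Fin N) K)) i j) ≤ 1 * C := mul_le_mul' hs (hA i j)
    _ = C := one_mul C

/-- A matrix `≡ 1` entrywise modulo an ideal of valuation `< 1` is integral (★ `isIntMatrix_of_forall_v_sub_one_lt_one`, `≤ C < 1` spelling). [cite: Serre1980Trees, Ch. II §1.1] -/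
theorem isIntMatrix_of_forall_v_sub_one_le_of_lt_one {N : ℕ} {A : Matrix (Fin N) (Fin N) K} {C : ℤᵐ⁰} (hC : C < 1) (hA : ∀ i j, Valued.v ((A - 1) i j) ≤ C) :
    IsIntMatrix A :=
  isIntMatrix_of_forall_v_sub_one_lt_one A fun i j => (hA i j).trans_lt hC

/-- … and so is the inverse of the corresponding `GL` element (★ `isIntMatrix_nonsing_inv_of_forall_v_sub_one_lt_one`, `Matrix.coe_units_inv`). [cite: Serre1980Trees, Ch. II §1.1] [cite: Kottwitz1986, §3] -/
theorem isIntMatrix_coe_inv_of_forall_v_sub_one_le_of_lt_one {N : ℕ} {g : GL (Fin N) K} {C : ℤᵐ⁰} (hC : C < 1)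
    (hg : ∀ i j, Valued.v (((g : Matrix (Fin N) (Fin N) K) - 1) i j) ≤ C) :
    IsIntMatrix ((g⁻¹ : GL (Fin N) K) : Matrix (Fin N) (Fin N) K) := by
  rw [Matrix.coe_units_inv]
  exact isIntMatrix_nonsing_inv_of_forall_v_sub_one_lt_one _ fun i j => (hg i j).trans_lt hC

/-- **THE DISCRIMINANT DEPTH SURVIVES CENTRING**: `|disc(s·A)| = |disc A|` for `|s| = 1` — the `hdisc` input of ★ `nonContraction_of_unitary_anisotropic` ∕ ★ (z6-h)
`strataCount_J₀_of_charpoly_block_raw_singleton_of_anisotropic_frame` at the centred block `s • ↑γ₁`. [cite: Rogawski1990, §4.9 p. 55] [cite: Kottwitz1986, §3] -/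
theorem v_trace_sq_sub_four_mul_det_smul {s : K} (hs : Valued.v s = 1) (A : Matrix (Fin 2) (Fin 2) K) :
    Valued.v ((s • A).trace ^ 2 - 4 * (s • A).det) = Valued.v (A.trace ^ 2 - 4 * A.det) := by
  rw [trace_sq_sub_four_mul_det_smul, map_mul, map_pow, hs, one_pow, one_mul]

/-- The entries of `s·A` are integral when those of `A` are and `|s| ≤ 1`. [cite: Serre1979, Ch. II §1] -/
theorem forall_v_smul_apply_le_one {N : ℕ} {s : K} (hs : Valued.v s ≤ 1) {A : Matrix (Fin N) (Fin N) K} (hA : ∀ i j, Valued.v (A i j) ≤ 1) :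
    ∀ i j, Valued.v ((s • A) i j) ≤ 1 := fun i j => by
  rw [Matrix.smul_apply, smul_eq_mul, map_mul]
  calc Valued.v s * Valued.v (A i j) ≤ 1 * 1 := mul_le_mul' hs (hA i j)
    _ = 1 := one_mul 1

/-- The `1 × 1` identity block is integral, and so is its inverse. [cite: Serre1979, Ch. II §1] -/
theorem isIntMatrix_coe_one {N : ℕ} : IsIntMatrix ((1 : GL (Fin N) K) : Matrix (Fin N) (Fin N) K) := by
  intro i j
  rw [Units.val_one]
  rcases eq_or_ne i j with rfl | hij
  · rw [Matrix.one_apply_eq, map_one]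
  · rw [Matrix.one_apply_ne hij, map_zero]; exact zero_le

end Integral

section GLInt

variable {K : Type*} [Field K] [Valued K ℤᵐ⁰] [ValuativeRel K] [(Valued.v : Valuation K ℤᵐ⁰).Compatible]

/-- `GL₃(𝒪)` BY ENTRIES for the conjugated pattern: `P ∈ GL₃(𝒪)` (★ `glInt`) and `a, a⁻¹, b, b⁻¹` integral ⇒ `P·ι(a, b)·P⁻¹ ∈ GL₃(𝒪)` (★ `mem_glInt_iff_forall_v_le_one`).
[cite: Rogawski1990, §4.9 p. 54] [cite: Serre1980Trees, Ch. II §1.1] -/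
theorem mem_glInt_conj_endoGL_of_isIntMatrix {P : GL (Fin 3) K} (hP : P ∈ glInt 3 K) {a : GL (Fin 2) K} {b : GL (Fin 1) K}
    (ha : IsIntMatrix (a : Matrix (Fin 2) (Fin 2) K)) (hai : IsIntMatrix ((a⁻¹ : GL (Fin 2) K) : Matrix (Fin 2) (Fin 2) K))
    (hb : IsIntMatrix (b : Matrix (Fin 1) (Fin 1) K)) (hbi : IsIntMatrix ((b⁻¹ : GL (Fin 1) K) : Matrix (Fin 1) (Fin 1) K)) :
    P * endoGL (a, b) * P⁻¹ ∈ glInt 3 K := by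
  obtain ⟨hP1, hP2⟩ := (mem_glInt_iff_forall_v_le_one P).1 hP
  exact (mem_glInt_iff_forall_v_le_one _).2 ⟨isIntMatrix_coe_conj_endoGL hP1 hP2 ha hb, isIntMatrix_coe_conj_endoGL_inv hP1 hP2 hai hbi⟩

/-- `GL₃(𝒪)` membership read as the pair of entrywise conditions (★ `mem_glInt_iff_forall_v_le_one`, ★ `IsIntMatrix` spelling). [cite: Serre1980Trees, Ch. II §1.1] -/
theorem isIntMatrix_and_isIntMatrix_inv_of_mem_glInt {N : ℕ} {P : GL (Fin N) K} (hP : P ∈ glInt N K) :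
    IsIntMatrix (P : Matrix (Fin N) (Fin N) K) ∧ IsIntMatrix ((P⁻¹ : GL (Fin N) K) : Matrix (Fin N) (Fin N) K) :=
  (mem_glInt_iff_forall_v_le_one P).1 hP

end GLInt

section UnitaryInt

variable {K : Type*} [Field K] [Valued K ℤᵐ⁰] {σ : K →+* K}

/-- **`K₀ = U ∩ GL_N(𝒪)` membership from the two entrywise conditions** (★ `mem_unitaryInt_iff`): the `hγ0` input of the junction head for `γ := ⟨Y′, _⟩`.
[cite: Rogawski1990, §4.9 p. 54] [cite: Serre1980Trees, Ch. II §1.1] -/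
theorem mem_unitaryInt_of_isIntMatrix {N : ℕ} {J : Matrix (Fin N) (Fin N) K} {g : GL (Fin N) K} (hg : g ∈ unitaryGroupOfForm σ J)
    (h1 : IsIntMatrix (g : Matrix (Fin N) (Fin N) K)) (h2 : IsIntMatrix ((g⁻¹ : GL (Fin N) K) : Matrix (Fin N) (Fin N) K)) :
    (⟨g, hg⟩ : unitaryGroupOfForm σ J) ∈ unitaryInt σ J :=
  mem_unitaryInt_iff.2 ⟨h1, h2⟩

end UnitaryInt

/-! ## §4 The junction head's `hchar ∕ hBm ∕ hroot` inputs AT THE CENTRED LITERAL `Y′ = P·ι(γ₁′, 1)·P⁻¹` -/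

section Head

variable {K : Type*} [Field K] [Valued K ℤᵐ⁰]

omit [Valued K ℤᵐ⁰] in
/-- **`hchar` at the centred literal**: `χ_{P·ι(a, 1)·P⁻¹} = (X − 1)·χ_a` — the junction head's `hchar` with `λ := 1`, `B := a` (for the block law, `a = u₀₀⁻¹·γ₁`).
[cite: Rogawski1990, §4.8 Case (a) p. 53; §4.9 p. 55] [cite: Kottwitz1986, §3] -/
theorem charpoly_coe_conj_endoGL_one (P : GL (Fin 3) K) (a : GL (Fin 2) K) :
    ((P * endoGL (a, (1 : GL (Fin 1) K)) * P⁻¹ : GL (Fin 3) K) : Matrix (Fin 3) (Fin 3) K).charpoly = (X - C (1 : K)) * (a : Matrix (Fin 2) (Fin 2) K).charpoly := by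
  rw [charpoly_coe_conj_endoGL, Units.val_one, Matrix.one_apply_eq]

/-- `hlam` at the centred literal is free: `|1 − 1| = 0 ≤ C`. [cite: Serre1979, Ch. II §1] -/
theorem v_one_sub_one_le (C : ℤᵐ⁰) : Valued.v ((1 : K) - 1) ≤ C := by
  rw [sub_self, map_zero]; exact zero_le

/-- The root is the lattice of an integral frame: `latt ↑P = L₀` for `P, P⁻¹` integral (★ `mapGL_stdLattice_eq_iff`; `mapGL P L₀ = latt ↑P` by definition).
[cite: Serre1980Trees, Ch. II §1.1] -/
theorem latt_coe_eq_stdLattice_of_isIntMatrix {N : ℕ} {P : GL (Fin N) K} (hP : IsIntMatrix (P : Matrix (Fin N) (Fin N) K))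
    (hPi : IsIntMatrix ((P⁻¹ : GL (Fin N) K) : Matrix (Fin N) (Fin N) K)) : latt (P : Matrix (Fin N) (Fin N) K) = stdLattice K N :=
  (mapGL_stdLattice_eq_iff P).2 ⟨hP, hPi⟩

/-- The entries of `ι(a, b) − 1` are entries of `a − 1`, the entry `b₀₀ − 1`, or `0`. [cite: Rogawski1990, §4.8 Case (a) p. 53] -/
theorem v_coe_endoGL_sub_one_apply_le {a : GL (Fin 2) K} {b : GL (Fin 1) K} {C : ℤᵐ⁰}
    (ha : ∀ i j, Valued.v (((a : Matrix (Fin 2) (Fin 2) K) - 1) i j) ≤ C) (hb : Valued.v ((b : Matrix (Fin 1) (Fin 1) K) 0 0 - 1) ≤ C) :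
    ∀ i j, Valued.v ((((endoGL (a, b) : GL (Fin 3) K) : Matrix (Fin 3) (Fin 3) K) - 1) i j) ≤ C := by
  have h00 := ha 0 0; have h01 := ha 0 1; have h10 := ha 1 0; have h11 := ha 1 1
  simp only [Matrix.sub_apply, Matrix.one_apply_eq, Matrix.one_apply_ne (show (0 : Fin 2) ≠ 1 by decide),
    Matrix.one_apply_ne (show (1 : Fin 2) ≠ 0 by decide), sub_zero] at h00 h01 h10 h11
  intro i j
  rw [coe_endoGL_eq]
  fin_cases i <;> fin_cases j
  · simpa using h00
  · simp
  · simpa using h01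
  · simp
  · simpa using hb
  · simp
  · simpa using h10
  · simp
  · simpa using h11

/-- **`hroot` for a conjugated pattern**: for `P, P⁻¹` integral, `c ≠ 0`, `|(a − 1)_{ij}| ≤ |c|` and `|b₀₀ − 1| ≤ |c|`: `(P·ι(a, b)·P⁻¹ − 1)·L₀ ⊆ c·L₀` — ★
`map_sub_one_latt_le_scaleLattice_iff` in the frame `P` (`latt ↑P = L₀`, `P⁻¹(P ι P⁻¹)P = ι`). [cite: Kottwitz1986, §3] [cite: Serre1980Trees, Ch. II §1.1] [cite: Rogawski1990, §4.9 p. 55] -/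
theorem map_sub_one_stdLattice_le_scaleLattice_of_conj_endoGL {c : K} (hc : c ≠ 0) {P : GL (Fin 3) K} (hP : IsIntMatrix (P : Matrix (Fin 3) (Fin 3) K))
    (hPi : IsIntMatrix ((P⁻¹ : GL (Fin 3) K) : Matrix (Fin 3) (Fin 3) K)) {a : GL (Fin 2) K} {b : GL (Fin 1) K}
    (ha : ∀ i j, Valued.v (((a : Matrix (Fin 2) (Fin 2) K) - 1) i j) ≤ Valued.v c) (hb : Valued.v ((b : Matrix (Fin 1) (Fin 1) K) 0 0 - 1) ≤ Valued.v c) :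
    (stdLattice K 3).map ((Matrix.toLin' (((P * endoGL (a, b) * P⁻¹ : GL (Fin 3) K) : Matrix (Fin 3) (Fin 3) K) - 1)).restrictScalars 𝒪[K]) ≤
      scaleLattice c (stdLattice K 3) := by
  have h := (map_sub_one_latt_le_scaleLattice_iff hc (P * endoGL (a, b) * P⁻¹) P).2 (by
    rw [show P⁻¹ * (P * endoGL (a, b) * P⁻¹) * P = endoGL (a, b) by group]
    exact v_coe_endoGL_sub_one_apply_le ha hb)
  rwa [latt_coe_eq_stdLattice_of_isIntMatrix hP hPi] at h

/-- **`hroot` AT THE CENTRED LITERAL**: for `P, P⁻¹` integral, `c ≠ 0` and `|(a − 1)_{ij}| ≤ |c|`: `(P·ι(a, 1)·P⁻¹ − 1)·L₀ ⊆ c·L₀`. [cite: Kottwitz1986, §3] [cite: Rogawski1990, §4.9 p. 55] -/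
theorem map_sub_one_stdLattice_le_scaleLattice_of_conj_endoGL_one {c : K} (hc : c ≠ 0) {P : GL (Fin 3) K} (hP : IsIntMatrix (P : Matrix (Fin 3) (Fin 3) K))
    (hPi : IsIntMatrix ((P⁻¹ : GL (Fin 3) K) : Matrix (Fin 3) (Fin 3) K)) {a : GL (Fin 2) K}
    (ha : ∀ i j, Valued.v (((a : Matrix (Fin 2) (Fin 2) K) - 1) i j) ≤ Valued.v c) :
    (stdLattice K 3).map ((Matrix.toLin' (((P * endoGL (a, (1 : GL (Fin 1) K)) * P⁻¹ : GL (Fin 3) K) : Matrix (Fin 3) (Fin 3) K) - 1)).restrictScalars 𝒪[K]) ≤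
      scaleLattice c (stdLattice K 3) :=
  map_sub_one_stdLattice_le_scaleLattice_of_conj_endoGL hc hP hPi ha (by rw [Units.val_one, Matrix.one_apply_eq]; exact v_one_sub_one_le _)

end Head

/-! ## §5 The five strata sets and the fixed vertices do not see a `2`-deep unit central rescaling of the element (`T″ = s·T`, `|s| = 1`, `|s − 1| ≤ |ϖ|²`) -/

section Strata

variable {K : Type*} [Field K] [Valued K ℤᵐ⁰] {N : ℕ} {σ : K →+* K} {ϖ : K}

/-- **THE FIVE STRATA SETS ARE INVARIANT UNDER A `2`-DEEP UNIT CENTRAL RESCALING OF THE ELEMENT** (one form `H` on both sides; `T` arbitrary): for `↑T″ = s • ↑T` with `|s| = 1`,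
`|s − 1| ≤ |ϖ|²`, and every `j ∈ {bd, reg, 1□_{C₁}, 1□_{C₂}, deep}`, the set of self-dual `T″`-fixed lattices in stratum `j` (tokens written with `T″`) IS the set of self-dual
`T`-fixed lattices in stratum `j` (tokens written with `T`) — ★ `UnitaryLatticeTreeCentralRescalingCountTransport` §1 token by token: fixedness (`mapGL_eq_of_coe_eq_smul`), the
level tokens `LEV(ϖ)`, `LEV(ϖ²)` (`map_toLin'_le_scaleLattice_of_eq_smul_add_smul`, both ways: `T″ − 1 = s(T − 1) + (s − 1)·1`, `T − 1 = s⁻¹(T″ − 1) + (s⁻¹ − 1)·1`), the square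
token under `LEV(ϖ)` (`map_toLin'_sq_le_…`), the class tokens on a self-dual `M` under `LEV(ϖ)` (`v_inv_mul_pairing_sub_lt_one_iff_…`).  For the block law: `T = Y =
P·ι(γ₁, u)·P⁻¹`, `T″ = Y′` (★ `coe_conj_endoGL_centred_eq_smul`), `H = J₀`, `C₁ = c₁`, `C₂ = c₁·ε`. [cite: Kottwitz1986, §3] [cite: Rogawski1990, §4.9 pp. 54–55, Lemma 4.9.3] [cite: BruhatTits1972, §10] -/
theorem setOf_strata_eq_of_coe_eq_smul (hvσ : ∀ a, Valued.v (σ a) = Valued.v a) (hϖ : Valued.v ϖ = WithZero.exp (-1 : ℤ)) (H : Matrix (Fin N) (Fin N) K)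
    {s : K} (hs : Valued.v s = 1) (hs1 : Valued.v (s - 1) ≤ Valued.v ϖ ^ 2)
    (T T'' : GL (Fin N) K) (hTT : (T'' : Matrix (Fin N) (Fin N) K) = s • (T : Matrix (Fin N) (Fin N) K)) (C₁ C₂ : K) (j : Fin 5) :
    {M : Submodule 𝒪[K] (Fin N → K) | IsSelfDualLattice σ ϖ H M ∧ mapGL T'' M = M ∧
        (![¬ M.map ((Matrix.toLin' ((T'' : Matrix (Fin N) (Fin N) K) - 1)).restrictScalars 𝒪[K]) ≤ scaleLattice ϖ M,
                  M.map ((Matrix.toLin' ((T'' : Matrix (Fin N) (Fin N) K) - 1)).restrictScalars 𝒪[K]) ≤ scaleLattice ϖ M ∧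
                    ¬ M.map ((Matrix.toLin' ((T'' : Matrix (Fin N) (Fin N) K) - 1)).restrictScalars 𝒪[K]) ≤ scaleLattice (ϖ ^ 2) M ∧
                    ¬ M.map ((Matrix.toLin' (((T'' : Matrix (Fin N) (Fin N) K) - 1) ^ 2)).restrictScalars 𝒪[K]) ≤ scaleLattice (ϖ ^ 3) M,
                  M.map ((Matrix.toLin' ((T'' : Matrix (Fin N) (Fin N) K) - 1)).restrictScalars 𝒪[K]) ≤ scaleLattice ϖ M ∧
                    ¬ M.map ((Matrix.toLin' ((T'' : Matrix (Fin N) (Fin N) K) - 1)).restrictScalars 𝒪[K]) ≤ scaleLattice (ϖ ^ 2) M ∧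
                    M.map ((Matrix.toLin' (((T'' : Matrix (Fin N) (Fin N) K) - 1) ^ 2)).restrictScalars 𝒪[K]) ≤ scaleLattice (ϖ ^ 3) M ∧
                    ∃ y ∈ M, ∃ a : K, Valued.v a = 1 ∧
                      Valued.v (ϖ⁻¹ * pairing σ H y (((T'' : Matrix (Fin N) (Fin N) K) - 1) *ᵥ y) - C₁ * a ^ 2) < 1,
                  M.map ((Matrix.toLin' ((T'' : Matrix (Fin N) (Fin N) K) - 1)).restrictScalars 𝒪[K]) ≤ scaleLattice ϖ M ∧
                    ¬ M.map ((Matrix.toLin' ((T'' : Matrix (Fin N) (Fin N) K) - 1)).restrictScalars 𝒪[K]) ≤ scaleLattice (ϖ ^ 2) M ∧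
                    M.map ((Matrix.toLin' (((T'' : Matrix (Fin N) (Fin N) K) - 1) ^ 2)).restrictScalars 𝒪[K]) ≤ scaleLattice (ϖ ^ 3) M ∧
                    ∃ y ∈ M, ∃ a : K, Valued.v a = 1 ∧
                      Valued.v (ϖ⁻¹ * pairing σ H y (((T'' : Matrix (Fin N) (Fin N) K) - 1) *ᵥ y) - C₂ * a ^ 2) < 1,
                  M.map ((Matrix.toLin' ((T'' : Matrix (Fin N) (Fin N) K) - 1)).restrictScalars 𝒪[K]) ≤ scaleLattice (ϖ ^ 2) M] : Fin 5 → Prop) j} =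
    {M : Submodule 𝒪[K] (Fin N → K) | IsSelfDualLattice σ ϖ H M ∧ mapGL T M = M ∧
        (![¬ M.map ((Matrix.toLin' ((T : Matrix (Fin N) (Fin N) K) - 1)).restrictScalars 𝒪[K]) ≤ scaleLattice ϖ M,
                  M.map ((Matrix.toLin' ((T : Matrix (Fin N) (Fin N) K) - 1)).restrictScalars 𝒪[K]) ≤ scaleLattice ϖ M ∧
                    ¬ M.map ((Matrix.toLin' ((T : Matrix (Fin N) (Fin N) K) - 1)).restrictScalars 𝒪[K]) ≤ scaleLattice (ϖ ^ 2) M ∧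
                    ¬ M.map ((Matrix.toLin' (((T : Matrix (Fin N) (Fin N) K) - 1) ^ 2)).restrictScalars 𝒪[K]) ≤ scaleLattice (ϖ ^ 3) M,
                  M.map ((Matrix.toLin' ((T : Matrix (Fin N) (Fin N) K) - 1)).restrictScalars 𝒪[K]) ≤ scaleLattice ϖ M ∧
                    ¬ M.map ((Matrix.toLin' ((T : Matrix (Fin N) (Fin N) K) - 1)).restrictScalars 𝒪[K]) ≤ scaleLattice (ϖ ^ 2) M ∧
                    M.map ((Matrix.toLin' (((T : Matrix (Fin N) (Fin N) K) - 1) ^ 2)).restrictScalars 𝒪[K]) ≤ scaleLattice (ϖ ^ 3) M ∧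
                    ∃ y ∈ M, ∃ a : K, Valued.v a = 1 ∧
                      Valued.v (ϖ⁻¹ * pairing σ H y (((T : Matrix (Fin N) (Fin N) K) - 1) *ᵥ y) - C₁ * a ^ 2) < 1,
                  M.map ((Matrix.toLin' ((T : Matrix (Fin N) (Fin N) K) - 1)).restrictScalars 𝒪[K]) ≤ scaleLattice ϖ M ∧
                    ¬ M.map ((Matrix.toLin' ((T : Matrix (Fin N) (Fin N) K) - 1)).restrictScalars 𝒪[K]) ≤ scaleLattice (ϖ ^ 2) M ∧
                    M.map ((Matrix.toLin' (((T : Matrix (Fin N) (Fin N) K) - 1) ^ 2)).restrictScalars 𝒪[K]) ≤ scaleLattice (ϖ ^ 3) M ∧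
                    ∃ y ∈ M, ∃ a : K, Valued.v a = 1 ∧
                      Valued.v (ϖ⁻¹ * pairing σ H y (((T : Matrix (Fin N) (Fin N) K) - 1) *ᵥ y) - C₂ * a ^ 2) < 1,
                  M.map ((Matrix.toLin' ((T : Matrix (Fin N) (Fin N) K) - 1)).restrictScalars 𝒪[K]) ≤ scaleLattice (ϖ ^ 2) M] : Fin 5 → Prop) j} := by
  have hϖ0 : ϖ ≠ 0 := fun h0 => by rw [h0, map_zero] at hϖ; exact WithZero.coe_ne_zero hϖ.symm
  have hϖ1 : Valued.v ϖ ≤ 1 := by rw [hϖ, ← WithZero.exp_zero]; exact WithZero.exp_le_exp.2 (by norm_num)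
  have hs0 : s ≠ 0 := fun h => by rw [h, map_zero] at hs; exact zero_ne_one hs
  -- `T″ − 1 = s(T − 1) + (s − 1)·1`, `T − 1 = s⁻¹(T″ − 1) + (s⁻¹ − 1)·1`
  have hB1 : (T'' : Matrix (Fin N) (Fin N) K) - 1 = s • ((T : Matrix (Fin N) (Fin N) K) - 1) + (s - 1) • (1 : Matrix (Fin N) (Fin N) K) := by
    rw [hTT, smul_sub, sub_smul, one_smul]; abel
  have hB2 : (T : Matrix (Fin N) (Fin N) K) - 1 = s⁻¹ • ((T'' : Matrix (Fin N) (Fin N) K) - 1) + (s⁻¹ - 1) • (1 : Matrix (Fin N) (Fin N) K) := by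
    rw [hTT, smul_sub, smul_smul, inv_mul_cancel₀ hs0, one_smul, sub_smul, one_smul]; abel
  have hsi : Valued.v s⁻¹ = 1 := by rw [map_inv₀, hs, inv_one]
  have hsi1 : Valued.v (s⁻¹ - 1) ≤ Valued.v ϖ ^ 2 := by
    rw [show s⁻¹ - 1 = s⁻¹ * (1 - s) by rw [mul_sub, mul_one, inv_mul_cancel₀ hs0], map_mul, hsi, one_mul, ← Valuation.map_neg, neg_sub]
    exact hs1
  have hϖ21 : Valued.v ϖ ^ 2 ≤ Valued.v ϖ := by rw [pow_two]; exact mul_le_of_le_one_left zero_le hϖ1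
  have hfix : ∀ M : Submodule 𝒪[K] (Fin N → K), mapGL T'' M = mapGL T M := mapGL_eq_of_coe_eq_smul hs hTT
  -- the level tokens of depth ≤ 2 move both ways
  have hL : ∀ (M : Submodule 𝒪[K] (Fin N → K)) (k : ℕ), k = 1 ∨ k = 2 →
      (M.map ((Matrix.toLin' ((T : Matrix (Fin N) (Fin N) K) - 1)).restrictScalars 𝒪[K]) ≤ scaleLattice (ϖ ^ k) M ↔
        M.map ((Matrix.toLin' ((T'' : Matrix (Fin N) (Fin N) K) - 1)).restrictScalars 𝒪[K]) ≤ scaleLattice (ϖ ^ k) M) := by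
    intro M k hk
    have hk' : Valued.v ϖ ^ 2 ≤ Valued.v (ϖ ^ k) := by
      rcases hk with rfl | rfl
      · rw [pow_one]; exact hϖ21
      · rw [map_pow]
    exact ⟨map_toLin'_le_scaleLattice_of_eq_smul_add_smul hB1 hs.le (pow_ne_zero _ hϖ0) (hs1.trans hk') M,
      map_toLin'_le_scaleLattice_of_eq_smul_add_smul hB2 hsi.le (pow_ne_zero _ hϖ0) (hsi1.trans hk') M⟩
  have hL1 : ∀ M : Submodule 𝒪[K] (Fin N → K),
      (M.map ((Matrix.toLin' ((T : Matrix (Fin N) (Fin N) K) - 1)).restrictScalars 𝒪[K]) ≤ scaleLattice ϖ M ↔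
        M.map ((Matrix.toLin' ((T'' : Matrix (Fin N) (Fin N) K) - 1)).restrictScalars 𝒪[K]) ≤ scaleLattice ϖ M) := fun M => by
    have h := hL M 1 (Or.inl rfl); rwa [pow_one] at h
  have hL2 := fun M => hL M 2 (Or.inr rfl)
  -- the square token, under `LEV (ϖ)`
  have hS : ∀ M : Submodule 𝒪[K] (Fin N → K), M.map ((Matrix.toLin' ((T : Matrix (Fin N) (Fin N) K) - 1)).restrictScalars 𝒪[K]) ≤ scaleLattice ϖ M →
      (M.map ((Matrix.toLin' (((T : Matrix (Fin N) (Fin N) K) - 1) ^ 2)).restrictScalars 𝒪[K]) ≤ scaleLattice (ϖ ^ 3) M ↔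
        M.map ((Matrix.toLin' (((T'' : Matrix (Fin N) (Fin N) K) - 1) ^ 2)).restrictScalars 𝒪[K]) ≤ scaleLattice (ϖ ^ 3) M) := fun M h1 =>
    ⟨map_toLin'_sq_le_scaleLattice_of_eq_smul_add_smul hϖ hB1 hs.le hs1 M h1,
      map_toLin'_sq_le_scaleLattice_of_eq_smul_add_smul hϖ hB2 hsi.le hsi1 M ((hL1 M).1 h1)⟩
  -- the class token, under self-duality and `LEV (ϖ)`
  have hC : ∀ (M : Submodule 𝒪[K] (Fin N → K)) (C : K), IsSelfDualLattice σ ϖ H M →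
      M.map ((Matrix.toLin' ((T : Matrix (Fin N) (Fin N) K) - 1)).restrictScalars 𝒪[K]) ≤ scaleLattice ϖ M →
      ((∃ y ∈ M, ∃ a : K, Valued.v a = 1 ∧ Valued.v (ϖ⁻¹ * pairing σ H y (((T : Matrix (Fin N) (Fin N) K) - 1) *ᵥ y) - C * a ^ 2) < 1) ↔
        ∃ y ∈ M, ∃ a : K, Valued.v a = 1 ∧ Valued.v (ϖ⁻¹ * pairing σ H y (((T'' : Matrix (Fin N) (Fin N) K) - 1) *ᵥ y) - C * a ^ 2) < 1) := by
    intro M C hSD h1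
    refine exists_congr fun y => and_congr_right fun hy => exists_congr fun a => and_congr_right fun _ => ?_
    exact (v_inv_mul_pairing_sub_lt_one_iff_of_eq_smul_add_smul hϖ σ H hB1 hs1 hs1
      (v_pairing_mulVec_le_of_map_le_scaleLattice hvσ hSD hϖ0 h1 hy) (v_pairing_self_le_one hvσ hSD hy) (C * a ^ 2)).symm
  ext M
  simp only [Set.mem_setOf_eq]
  refine and_congr_right fun hSD => ?_
  rw [hfix M]
  refine and_congr_right fun _ => ?_
  fin_cases j
  · -- bd
    simp only [Fin.zero_eta, Fin.isValue, Matrix.cons_val_zero]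
    rw [hL1 M]
  · -- reg
    simp only [Fin.mk_one, Fin.isValue, Matrix.cons_val_one, Matrix.cons_val_zero]
    exact ⟨fun ⟨h1, h2, h3⟩ => ⟨(hL1 M).2 h1, fun h => h2 ((hL2 M).1 h), fun h => h3 ((hS M ((hL1 M).2 h1)).1 h)⟩,
      fun ⟨h1, h2, h3⟩ => ⟨(hL1 M).1 h1, fun h => h2 ((hL2 M).2 h), fun h => h3 ((hS M h1).2 h)⟩⟩
  · -- 1□ class C₁
    simp only [Fin.reduceFinMk, Matrix.cons_val]
    exact ⟨fun ⟨h1, h2, h3, h4⟩ => ⟨(hL1 M).2 h1, fun h => h2 ((hL2 M).1 h), (hS M ((hL1 M).2 h1)).2 h3, (hC M _ hSD ((hL1 M).2 h1)).2 h4⟩,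
      fun ⟨h1, h2, h3, h4⟩ => ⟨(hL1 M).1 h1, fun h => h2 ((hL2 M).2 h), (hS M h1).1 h3, (hC M _ hSD h1).1 h4⟩⟩
  · -- 1□ class C₂
    simp only [Fin.reduceFinMk, Matrix.cons_val]
    exact ⟨fun ⟨h1, h2, h3, h4⟩ => ⟨(hL1 M).2 h1, fun h => h2 ((hL2 M).1 h), (hS M ((hL1 M).2 h1)).2 h3, (hC M _ hSD ((hL1 M).2 h1)).2 h4⟩,
      fun ⟨h1, h2, h3, h4⟩ => ⟨(hL1 M).1 h1, fun h => h2 ((hL2 M).2 h), (hS M h1).1 h3, (hC M _ hSD h1).1 h4⟩⟩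
  · -- deep
    simp only [Fin.reduceFinMk, Matrix.cons_val]
    rw [hL2 M]

/-- **… hence the five strata COUNTS agree** (`Set.ncard` of the two sides of `setOf_strata_eq_of_coe_eq_smul`). [cite: Kottwitz1986, §3] [cite: Rogawski1990, §4.9 pp. 54–55, Lemma 4.9.3] -/
theorem ncard_strata_eq_of_coe_eq_smul (hvσ : ∀ a, Valued.v (σ a) = Valued.v a) (hϖ : Valued.v ϖ = WithZero.exp (-1 : ℤ)) (H : Matrix (Fin N) (Fin N) K)
    {s : K} (hs : Valued.v s = 1) (hs1 : Valued.v (s - 1) ≤ Valued.v ϖ ^ 2)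
    (T T'' : GL (Fin N) K) (hTT : (T'' : Matrix (Fin N) (Fin N) K) = s • (T : Matrix (Fin N) (Fin N) K)) (C₁ C₂ : K) (j : Fin 5) :
    ({M : Submodule 𝒪[K] (Fin N → K) | IsSelfDualLattice σ ϖ H M ∧ mapGL T'' M = M ∧
        (![¬ M.map ((Matrix.toLin' ((T'' : Matrix (Fin N) (Fin N) K) - 1)).restrictScalars 𝒪[K]) ≤ scaleLattice ϖ M,
                  M.map ((Matrix.toLin' ((T'' : Matrix (Fin N) (Fin N) K) - 1)).restrictScalars 𝒪[K]) ≤ scaleLattice ϖ M ∧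
                    ¬ M.map ((Matrix.toLin' ((T'' : Matrix (Fin N) (Fin N) K) - 1)).restrictScalars 𝒪[K]) ≤ scaleLattice (ϖ ^ 2) M ∧
                    ¬ M.map ((Matrix.toLin' (((T'' : Matrix (Fin N) (Fin N) K) - 1) ^ 2)).restrictScalars 𝒪[K]) ≤ scaleLattice (ϖ ^ 3) M,
                  M.map ((Matrix.toLin' ((T'' : Matrix (Fin N) (Fin N) K) - 1)).restrictScalars 𝒪[K]) ≤ scaleLattice ϖ M ∧
                    ¬ M.map ((Matrix.toLin' ((T'' : Matrix (Fin N) (Fin N) K) - 1)).restrictScalars 𝒪[K]) ≤ scaleLattice (ϖ ^ 2) M ∧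
                    M.map ((Matrix.toLin' (((T'' : Matrix (Fin N) (Fin N) K) - 1) ^ 2)).restrictScalars 𝒪[K]) ≤ scaleLattice (ϖ ^ 3) M ∧
                    ∃ y ∈ M, ∃ a : K, Valued.v a = 1 ∧
                      Valued.v (ϖ⁻¹ * pairing σ H y (((T'' : Matrix (Fin N) (Fin N) K) - 1) *ᵥ y) - C₁ * a ^ 2) < 1,
                  M.map ((Matrix.toLin' ((T'' : Matrix (Fin N) (Fin N) K) - 1)).restrictScalars 𝒪[K]) ≤ scaleLattice ϖ M ∧
                    ¬ M.map ((Matrix.toLin' ((T'' : Matrix (Fin N) (Fin N) K) - 1)).restrictScalars 𝒪[K]) ≤ scaleLattice (ϖ ^ 2) M ∧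
                    M.map ((Matrix.toLin' (((T'' : Matrix (Fin N) (Fin N) K) - 1) ^ 2)).restrictScalars 𝒪[K]) ≤ scaleLattice (ϖ ^ 3) M ∧
                    ∃ y ∈ M, ∃ a : K, Valued.v a = 1 ∧
                      Valued.v (ϖ⁻¹ * pairing σ H y (((T'' : Matrix (Fin N) (Fin N) K) - 1) *ᵥ y) - C₂ * a ^ 2) < 1,
                  M.map ((Matrix.toLin' ((T'' : Matrix (Fin N) (Fin N) K) - 1)).restrictScalars 𝒪[K]) ≤ scaleLattice (ϖ ^ 2) M] : Fin 5 → Prop) j}.ncard) =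
    ({M : Submodule 𝒪[K] (Fin N → K) | IsSelfDualLattice σ ϖ H M ∧ mapGL T M = M ∧
        (![¬ M.map ((Matrix.toLin' ((T : Matrix (Fin N) (Fin N) K) - 1)).restrictScalars 𝒪[K]) ≤ scaleLattice ϖ M,
                  M.map ((Matrix.toLin' ((T : Matrix (Fin N) (Fin N) K) - 1)).restrictScalars 𝒪[K]) ≤ scaleLattice ϖ M ∧
                    ¬ M.map ((Matrix.toLin' ((T : Matrix (Fin N) (Fin N) K) - 1)).restrictScalars 𝒪[K]) ≤ scaleLattice (ϖ ^ 2) M ∧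
                    ¬ M.map ((Matrix.toLin' (((T : Matrix (Fin N) (Fin N) K) - 1) ^ 2)).restrictScalars 𝒪[K]) ≤ scaleLattice (ϖ ^ 3) M,
                  M.map ((Matrix.toLin' ((T : Matrix (Fin N) (Fin N) K) - 1)).restrictScalars 𝒪[K]) ≤ scaleLattice ϖ M ∧
                    ¬ M.map ((Matrix.toLin' ((T : Matrix (Fin N) (Fin N) K) - 1)).restrictScalars 𝒪[K]) ≤ scaleLattice (ϖ ^ 2) M ∧
                    M.map ((Matrix.toLin' (((T : Matrix (Fin N) (Fin N) K) - 1) ^ 2)).restrictScalars 𝒪[K]) ≤ scaleLattice (ϖ ^ 3) M ∧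
                    ∃ y ∈ M, ∃ a : K, Valued.v a = 1 ∧
                      Valued.v (ϖ⁻¹ * pairing σ H y (((T : Matrix (Fin N) (Fin N) K) - 1) *ᵥ y) - C₁ * a ^ 2) < 1,
                  M.map ((Matrix.toLin' ((T : Matrix (Fin N) (Fin N) K) - 1)).restrictScalars 𝒪[K]) ≤ scaleLattice ϖ M ∧
                    ¬ M.map ((Matrix.toLin' ((T : Matrix (Fin N) (Fin N) K) - 1)).restrictScalars 𝒪[K]) ≤ scaleLattice (ϖ ^ 2) M ∧
                    M.map ((Matrix.toLin' (((T : Matrix (Fin N) (Fin N) K) - 1) ^ 2)).restrictScalars 𝒪[K]) ≤ scaleLattice (ϖ ^ 3) M ∧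
                    ∃ y ∈ M, ∃ a : K, Valued.v a = 1 ∧
                      Valued.v (ϖ⁻¹ * pairing σ H y (((T : Matrix (Fin N) (Fin N) K) - 1) *ᵥ y) - C₂ * a ^ 2) < 1,
                  M.map ((Matrix.toLin' ((T : Matrix (Fin N) (Fin N) K) - 1)).restrictScalars 𝒪[K]) ≤ scaleLattice (ϖ ^ 2) M] : Fin 5 → Prop) j}.ncard) := by
  rw [setOf_strata_eq_of_coe_eq_smul hvσ hϖ H hs hs1 T T'' hTT C₁ C₂ j]

/-- **FIXED VERTICES DO NOT SEE A UNIT CENTRAL RESCALING**: for `γ, γ″ ∈ U(σ, H)` with `↑γ″ = s • ↑γ`, `|s| = 1`, a vertex is `γ″`-fixed iff it is `γ`-fixed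
(★ `mapGL_eq_of_coe_eq_smul`). [cite: BruhatTits1972, §10] [cite: Serre1980Trees, Ch. II §1.1] -/
theorem latticeGraphIso_eq_self_iff_of_coe_eq_smul (H : Matrix (Fin N) (Fin N) K) {s : K} (hs : Valued.v s = 1)
    (γ γ'' : unitaryGroupOfForm σ H) (hγγ : ((γ'' : GL (Fin N) K) : Matrix (Fin N) (Fin N) K) = s • ((γ : GL (Fin N) K) : Matrix (Fin N) (Fin N) K))
    (v : {M : Submodule 𝒪[K] (Fin N → K) // IsVertex σ ϖ H M}) :
    latticeGraphIso σ ϖ H γ'' v = v ↔ latticeGraphIso σ ϖ H γ v = v := by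
  rw [Subtype.ext_iff, Subtype.ext_iff, latticeGraphIso_apply_coe, latticeGraphIso_apply_coe]
  change mapGL (γ'' : GL (Fin N) K) v.1 = v.1 ↔ mapGL (γ : GL (Fin N) K) v.1 = v.1
  rw [mapGL_eq_of_coe_eq_smul hs hγγ]

/-- … as an equality of fixed-vertex SETS (so the finiteness `hFfin` and every `γ`-fixedness clause move between `γ` and `γ″`). [cite: BruhatTits1972, §10] [cite: Serre1980Trees, Ch. II §1.1] -/
theorem setOf_latticeGraphIso_eq_self_eq_of_coe_eq_smul (H : Matrix (Fin N) (Fin N) K) {s : K} (hs : Valued.v s = 1)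
    (γ γ'' : unitaryGroupOfForm σ H) (hγγ : ((γ'' : GL (Fin N) K) : Matrix (Fin N) (Fin N) K) = s • ((γ : GL (Fin N) K) : Matrix (Fin N) (Fin N) K)) :
    {v : {M : Submodule 𝒪[K] (Fin N → K) // IsVertex σ ϖ H M} | latticeGraphIso σ ϖ H γ'' v = v} =
      {v : {M : Submodule 𝒪[K] (Fin N → K) // IsVertex σ ϖ H M} | latticeGraphIso σ ϖ H γ v = v} := by
  ext v
  exact latticeGraphIso_eq_self_iff_of_coe_eq_smul H hs γ γ'' hγγ v

/-- The unit `u₀₀⁻¹` of a `2`-deep norm-one middle eigenvalue is again `2`-deep: `|u₀₀| = 1`, `|u₀₀ − 1| ≤ |ϖ|²`, `s·u₀₀ = 1` ⇒ `|s| = 1 ∧ |s − 1| ≤ |ϖ|²`.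
[cite: Serre1979, Ch. II §1] [cite: Kottwitz1986, §3] -/
theorem v_eq_one_and_v_sub_one_le_of_mul_eq_one {t s : K} (ht : Valued.v t = 1) (ht1 : Valued.v (t - 1) ≤ Valued.v ϖ ^ 2) (hs : s * t = 1) :
    Valued.v s = 1 ∧ Valued.v (s - 1) ≤ Valued.v ϖ ^ 2 := by
  have ht0 : t ≠ 0 := fun h => by rw [h, map_zero] at ht; exact zero_ne_one ht
  have hs' : s = t⁻¹ := eq_inv_of_mul_eq_one_left hs
  refine ⟨by rw [hs', map_inv₀, ht, inv_one], ?_⟩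
  rw [hs', show t⁻¹ - 1 = t⁻¹ * (1 - t) by rw [mul_sub, mul_one, inv_mul_cancel₀ ht0], map_mul, map_inv₀, ht, inv_one, one_mul,
    ← Valuation.map_neg, neg_sub]
  exact ht1

end Strata


/-! ## §6 (ED. 2) The socket's determinant depth: entry sizes of the centred block, `hA′` from `|det| = |ϖ|^{2d₀}`, entrywise depth from conformality -/

section DetDepth

variable {K : Type*} [Field K] [Valued K ℤᵐ⁰]

/-- **THE ENTRY SIZES OF THE CENTRED BLOCK ARE THOSE OF `γ₁ − u₀₀·1`**: `s·t = 1`, `|s| = 1` ⇒ `|(s·A − 1·1)_{ij}| = |(A − t·1)_{ij}|` (`s·A − 1 = s·(A − t·1)`). [cite: Kottwitz1986, §3] -/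
theorem v_smul_sub_one_smul_one_apply_eq_of_mul_eq_one {N : ℕ} (A : Matrix (Fin N) (Fin N) K) {s t : K} (hst : s * t = 1) (hs : Valued.v s = 1) (i j : Fin N) :
    Valued.v ((s • A - (1 : K) • (1 : Matrix (Fin N) (Fin N) K)) i j) = Valued.v ((A - t • (1 : Matrix (Fin N) (Fin N) K)) i j) := by
  have e : s • A - (1 : K) • (1 : Matrix (Fin N) (Fin N) K) = s • (A - t • (1 : Matrix (Fin N) (Fin N) K)) := by
    rw [smul_sub, smul_smul, hst]
  rw [e, Matrix.smul_apply, smul_eq_mul, map_mul, hs, one_mul]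

/-- … so a lower bound on some entry of `γ₁ − u₀₀·1` is a lower bound on the same entry of the centred block minus `1` (the `hA′` input of ★
`nonContraction_of_unitary_anisotropic_of_entry` at the centred literal). [cite: Kottwitz1986, §3] -/
theorem exists_le_v_smul_sub_one_smul_one_apply_of_mul_eq_one {N : ℕ} {A : Matrix (Fin N) (Fin N) K} {s t : K} (hst : s * t = 1) (hs : Valued.v s = 1) {μ : ℤᵐ⁰}
    (h : ∃ i j, μ ≤ Valued.v ((A - t • (1 : Matrix (Fin N) (Fin N) K)) i j)) :
    ∃ i j, μ ≤ Valued.v ((s • A - (1 : K) • (1 : Matrix (Fin N) (Fin N) K)) i j) := by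
  obtain ⟨i, j, hij⟩ := h
  exact ⟨i, j, by rwa [v_smul_sub_one_smul_one_apply_eq_of_mul_eq_one A hst hs i j]⟩

/-- **`|det T| ≥ μ²` FORCES AN ENTRY OF SIZE `≥ μ`** (`2 × 2`; ultrametric: `|T₀₀T₁₁ − T₀₁T₁₀| ≤ max |T_{ij}|²`). [cite: Serre1979, Ch. II §1] -/
theorem exists_le_v_apply_of_mul_self_le_v_det (T : Matrix (Fin 2) (Fin 2) K) {μ : ℤᵐ⁰} (h : μ * μ ≤ Valued.v T.det) : ∃ i j, μ ≤ Valued.v (T i j) := by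
  by_contra hne
  push Not at hne
  have hlt : Valued.v T.det < μ * μ := by
    rw [Matrix.det_fin_two]
    refine (Valuation.map_sub _ _ _).trans_lt (max_lt ?_ ?_)
    · rw [map_mul]; exact mul_lt_mul'' (hne 0 0) (hne 1 1) zero_le zero_le
    · rw [map_mul]; exact mul_lt_mul'' (hne 0 1) (hne 1 0) zero_le zero_le
  exact absurd h (not_le.2 hlt)

/-- **`|det T| = |ϖ|^{2d₀}` FORCES AN ENTRY OF SIZE `≥ |ϖ|^{d₀}`** — the `hA′` input from the socket's determinant depth. [cite: Kottwitz1986, §3] [cite: Rogawski1990, §4.9 p. 55] -/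
theorem exists_pow_le_v_apply_of_v_det_eq {ϖ : K} (T : Matrix (Fin 2) (Fin 2) K) {d₀ : ℕ} (h : Valued.v T.det = Valued.v ϖ ^ (2 * d₀)) :
    ∃ i j, Valued.v ϖ ^ d₀ ≤ Valued.v (T i j) :=
  exists_le_v_apply_of_mul_self_le_v_det T (by rw [h, ← pow_add, two_mul])

/-- **CONFORMALITY + DETERMINANT DEPTH GIVE THE ENTRYWISE DEPTH**: if `|T_{ij}|² ≤ |det T|` for all `i, j` and `|det T| = |ϖ|^{2d₀}` then `|T_{ij}| ≤ |ϖ|^{d₀}`.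
[cite: Kottwitz1986, §3] [cite: Rogawski1990, §4.9 p. 55] -/
theorem forall_v_apply_le_pow_of_mul_self_le_det_of_v_det_eq {ϖ : K} {N : ℕ} (T : Matrix (Fin N) (Fin N) K) {d₀ : ℕ}
    (hconf : ∀ i j, Valued.v (T i j) * Valued.v (T i j) ≤ Valued.v T.det) (h : Valued.v T.det = Valued.v ϖ ^ (2 * d₀)) :
    ∀ i j, Valued.v (T i j) ≤ Valued.v ϖ ^ d₀ := by
  intro i j
  by_contra hlt
  push Not at hlt
  have h2 : Valued.v ϖ ^ (2 * d₀) < Valued.v (T i j) * Valued.v (T i j) := by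
    rw [two_mul, pow_add]; exact mul_lt_mul'' hlt hlt zero_le zero_le
  exact absurd ((hconf i j).trans_eq h) (not_le.2 h2)

end DetDepth

end Literature.NumberTheory.Automorphic.UnitaryLatticeTree

end
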